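import Literature.NumberTheory.BeurlingPrimes.HilberdinkZeroOrder
import HarnessLib

/-!
# Hilberdink's uncertainty principle, V bis: the Lindelöf-type bound `Z(σ+it) = O(|t|^ε)` and its Mellin form

Topic `Literature/NumberTheory/BeurlingPrimes`, grouping namespace `Hilberdink`. Everything in this
file is PROVED. It finishes Hilberdink–Lapidus 2006, Theorem 2.3 ("Theorem A" of Hilberdink 2005,
§3) for the continuation `Z` of `ζ_P` of a system with `|N_P(x) − ax| ≤ Cx^θ`, `|ψ_P(x) − x| ≤ Cx^θ`
(`x ≥ 1`, `a > 0`, `0 ≤ θ < 1`), starting from the holomorphic logarithm `G` with the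
Borel–Carathéodory bound of `HilberdinkZeroOrder.lean` (`exists_log_Z`):
* `norm_log_le_rpow`: Hadamard's three circles (tree: `InvZetaRH.norm_le_of_three_circles`), radii
  `1`, `5/2 − σ`, `5/2 − θ − δ` about `5/2 + it`, give `‖G(σ+it)‖ ≤ B₂ (A₃δ⁻¹ log|t|)^{a₀}`,
  `a₀ < 1`, for `θ + 2δ ≤ σ ≤ 3/2` ("We apply Hadamard's Three-Circles Theorem to the circles … The
  exponent, `κ`, can be made as close as we please to `(1−σ)/(1−Θ)`");
* **`norm_Z_le_rpow`** (Theorem 2.3, the clause used: "In particular, `ζ(σ+it) = O(|t|^ε)`"): for every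
  `ε > 0` there is `T` with `‖Z(σ+it)‖ ≤ e^{B_L}|t|^ε` for `σ ≥ θ + 2δ`, `|t| ≥ T`;
* **`exists_norm_mellin_errN_le`**: hence, for `θ < σ₁ < 1` and `0 < ε ≤ 1`,
  `‖∫₁^∞ E(x) x^{−σ₁−1+it} dx‖ ≤ K(1+|t|)^{ε−1}` for all real `t` — the input of the `L²` argument.

## References
* T. W. Hilberdink, M. L. Lapidus, *Beurling zeta functions, generalised primes, and fractal
  membranes*, Acta Appl. Math. 94 (2006), arXiv:math/0410270, Theorem 2.3 and its proof.
* [Hilberdink2005] T. W. Hilberdink, *Well-behaved Beurling primes and integers*, J. Number Theory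
  112 (2005) 332–344, §3 Theorem A.
* E. C. Titchmarsh, *The Theory of the Riemann Zeta-Function*, 2nd ed. (1986), §14.2.
-/

noncomputable section

open Set Filter Complex Metric
open scoped Topology Real

namespace Literature.NumberTheory.BeurlingPrimes

open Literature.Barriers.RiemannHypothesis
open Literature.NumberTheory.LFunctions.InvZetaRH (norm_le_of_three_circles one_le_log_abs)

namespace Hilberdink

variable {P : BeurlingPrimes} {a C θ δ t : ℝ}

section hyp

/-- **Three-circles interpolation** (Hilberdink–Lapidus, proof of Thm 2.3; Titchmarsh §14.2): with `G`
as in `exists_log_Z`, circles centred `5/2 + it` of radii `1` (`‖G‖ = ‖L‖ ≤ B₂` there),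
`5/2 − σ`, `5/2 − θ − δ` give `‖G(σ+it)‖ ≤ B₂ (A₃ δ⁻¹ log|t|)^{a₀}` for `θ + 2δ ≤ σ ≤ 3/2`.
[cite: Hilberdink2005, §3 Theorem A] -/
theorem norm_log_le_rpow (hθ : θ < 1) (hN : ∀ x : ℝ, 1 ≤ x → |(P.intCount x : ℝ) - a * x| ≤ C * x ^ θ)
    (hδ : 0 < δ) (hδ2 : δ ≤ 1 / 4) (ht : 7 ≤ |t|) {G : ℂ → ℂ}
    (hGd : DifferentiableOn ℂ G (ball (dctr t) (R₀ θ δ)))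
    (hV : ∀ z ∈ ball (dctr t) (R₀ θ δ), 1 < z.re → G z = eulerLog P z)
    (hM₃ : ∀ z ∈ closedBall (dctr t) (r₃ θ δ), ‖G z‖ ≤ A₃ P / δ * Real.log |t|)
    {σ : ℝ} (hσ₁ : θ + 2 * δ ≤ σ) (hσ₂ : σ ≤ 3 / 2) :
    ‖G (σ + t * I)‖ ≤ B₂ P * (A₃ P / δ * Real.log |t|) ^ a₀ θ δ := by
  have hB := intCount_le_of_abs_le P hθ.le hN
  set c : ℂ := dctr t with hc
  set M₃ : ℝ := A₃ P / δ * Real.log |t| with hM₃def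
  have hlog1 : 1 ≤ Real.log |t| := one_le_log_abs ht
  have h40 := forty_le_A₃_div P hδ (by linarith)
  have hM₃1 : 1 ≤ M₃ := by rw [hM₃def]; nlinarith
  have hR₀ : 0 < R₀ θ δ := by unfold R₀; linarith
  have h13 : (1 : ℝ) < r₃ θ δ := by unfold r₃; linarith
  have h3R : r₃ θ δ < R₀ θ δ := by unfold r₃ R₀; linarith
  -- bounds on the two circles
  have hM₁ : ∀ z : ℂ, ‖z - c‖ = 1 → ‖G z‖ ≤ B₂ P := by
    intro z hz
    have hzb : z ∈ ball c (R₀ θ δ) := by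
      rw [mem_ball, dist_eq_norm, hz]; unfold R₀; linarith
    have hzre : 3 / 2 ≤ z.re := by
      have h := abs_re_le_norm (z - c)
      rw [hz] at h
      simp only [sub_re, hc, dctr_re] at h
      have := neg_abs_le (z.re - 5 / 2)
      linarith
    rw [hV z hzb (by linarith)]
    exact (norm_eulerLog_le_BL hB hzre).trans (le_max_left _ _)
  have hM₃' : ∀ z : ℂ, ‖z - c‖ = r₃ θ δ → ‖G z‖ ≤ M₃ := fun z hz ↦
    hM₃ z (by rw [mem_closedBall, dist_eq_norm, hz])
  -- the point `σ + it`
  set z : ℂ := σ + t * I with hzdef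
  have hzc : z - c = ((σ - 5 / 2 : ℝ) : ℂ) := by
    simp only [hzdef, hc, dctr]; push_cast; ring
  have hnorm : ‖z - c‖ = 5 / 2 - σ := by
    rw [hzc, Complex.norm_real, Real.norm_eq_abs, abs_of_nonpos (by linarith)]; ring
  have hz₁ : 1 ≤ ‖z - c‖ := by rw [hnorm]; linarith
  have hz₃ : ‖z - c‖ ≤ r₃ θ δ := by rw [hnorm]; unfold r₃; linarith
  have key := norm_le_of_three_circles one_pos h13 h3R hGd hM₁ hM₃' hz₁ hz₃
  -- the exponent
  set b : ℝ := Real.log (‖z - c‖ / 1) / Real.log (r₃ θ δ / 1) with hbdef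
  have hden : 0 < Real.log (r₃ θ δ / 1) := Real.log_pos (by rw [div_one]; exact h13)
  have hb0 : 0 ≤ b := div_nonneg (Real.log_nonneg (by rw [hnorm, div_one]; linarith)) hden.le
  have hb1 : b ≤ a₀ θ δ := by
    rw [hbdef, hnorm, div_one, div_one]
    unfold a₀ r₃
    exact div_le_div_of_nonneg_right (Real.log_le_log (by linarith) (by linarith))
      (Real.log_pos (by linarith)).le
  have hb1' : b ≤ 1 := hb1.trans (a₀_lt_one hθ hδ hδ2).le
  have hB₂ := one_le_B₂ P
  have e1 : B₂ P ^ (1 - b) ≤ B₂ P := by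
    calc B₂ P ^ (1 - b) ≤ B₂ P ^ (1 : ℝ) := Real.rpow_le_rpow_of_exponent_le hB₂ (by linarith)
      _ = B₂ P := Real.rpow_one _
  have e2 : M₃ ^ b ≤ M₃ ^ a₀ θ δ := Real.rpow_le_rpow_of_exponent_le hM₃1 hb1
  calc ‖G z‖ ≤ B₂ P ^ (1 - b) * M₃ ^ b := key
    _ ≤ B₂ P * M₃ ^ a₀ θ δ :=
        mul_le_mul e1 e2 (Real.rpow_nonneg (by linarith) _) (by linarith)

/-- **Hilberdink–Lapidus 2006, Theorem 2.3 (zero order): `Z(σ+it) = O(|t|^ε)` uniformly for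
`σ ≥ θ + 2δ`.** For every `ε > 0` (and `0 < δ ≤ 1/4`) there is `T` with
`‖Z(σ+it)‖ ≤ e^{B_L} |t|^ε` for all `σ ≥ θ + 2δ` and `|t| ≥ T`. [cite: Hilberdink2005, §3 Theorem A] -/
theorem norm_Z_le_rpow (ha : 0 < a) (hθ0 : 0 ≤ θ) (hθ : θ < 1) (hN : ∀ x : ℝ, 1 ≤ x → |(P.intCount x : ℝ) - a * x| ≤ C * x ^ θ)
    (hψ : ∀ x : ℝ, 1 ≤ x → |P.chebyshevPsi x - x| ≤ C * x ^ θ) (hδ : 0 < δ) (hδ2 : δ ≤ 1 / 4) {ε : ℝ} (hε : 0 < ε) :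
    ∃ T : ℝ, 7 ≤ T ∧ ∀ σ t : ℝ, θ + 2 * δ ≤ σ → T ≤ |t| →
      ‖Z P a (σ + t * I)‖ ≤ Real.exp (BL P) * |t| ^ ε := by
  have hB := intCount_le_of_abs_le P hθ.le hN
  set K : ℝ := A₃ P / δ with hK
  have hK40 : 40 ≤ K := forty_le_A₃_div P hδ (by linarith)
  set b : ℝ := a₀ θ δ with hb
  have hb1 : b < 1 := a₀_lt_one hθ hδ hδ2
  have hb0 : 0 ≤ b := a₀_nonneg hθ hδ hδ2
  have hB₂ := one_le_B₂ P
  set Y : ℝ := (B₂ P * K / ε) ^ (1 / (1 - b)) with hY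
  have hY0 : 0 ≤ Y := Real.rpow_nonneg (by positivity) _
  set T : ℝ := max (T₁ a C δ) (Real.exp Y) with hT
  have hT7 : 7 ≤ T := le_trans (le_max_left _ _) (le_max_left _ _)
  refine ⟨T, hT7, fun σ t hσ ht ↦ ?_⟩
  have hT₁ : T₁ a C δ ≤ |t| := le_trans (le_max_left _ _) ht
  have ht7 : 7 ≤ |t| := le_trans hT7 ht
  have htY : Real.exp Y ≤ |t| := le_trans (le_max_right _ _) ht
  have htpos : 0 < |t| := by linarith
  have hlog1 : 1 ≤ Real.log |t| := one_le_log_abs ht7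
  have hlogY : Y ≤ Real.log |t| := (Real.le_log_iff_exp_le htpos).mpr htY
  have hexpBL : 1 ≤ Real.exp (BL P) := Real.one_le_exp (BL_nonneg P)
  have htε : 1 ≤ |t| ^ ε := Real.one_le_rpow (by linarith) hε.le
  by_cases hσ5 : σ ≤ 3 / 2
  · obtain ⟨G, hGd, hexp, hV, hM₃⟩ := exists_log_Z ha hθ0 hθ hN hψ hδ (by linarith) hT₁
    set z : ℂ := σ + t * I with hzdef
    have hzball : z ∈ ball (dctr t) (R₀ θ δ) := by
      have hzc : z - dctr t = ((σ - 5 / 2 : ℝ) : ℂ) := by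
        simp only [hzdef, dctr]; push_cast; ring
      rw [mem_ball, dist_eq_norm, hzc, Complex.norm_real, Real.norm_eq_abs,
        abs_of_nonpos (by linarith)]
      unfold R₀; linarith
    have hLz : ‖G z‖ ≤ B₂ P * (K * Real.log |t|) ^ b :=
      norm_log_le_rpow hθ hN hδ hδ2 ht7 hGd hV hM₃ hσ hσ5
    -- `B₂ (K log|t|)^b ≤ ε log|t|`
    have hK1 : 1 ≤ K := by linarith
    have hKb : (K * Real.log |t|) ^ b ≤ K * Real.log |t| ^ b := by
      rw [Real.mul_rpow (by linarith) (by linarith)]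
      gcongr
      calc K ^ b ≤ K ^ (1 : ℝ) := Real.rpow_le_rpow_of_exponent_le hK1 hb1.le
        _ = K := Real.rpow_one K
    have hpow : B₂ P * K / ε ≤ Real.log |t| ^ (1 - b) := by
      have h1 : Y ^ (1 - b) = B₂ P * K / ε := by
        rw [hY, ← Real.rpow_mul (by positivity), one_div_mul_cancel (by linarith), Real.rpow_one]
      rw [← h1]
      exact Real.rpow_le_rpow hY0 hlogY (by linarith)
    have hsplit : Real.log |t| = Real.log |t| ^ b * Real.log |t| ^ (1 - b) := by
      rw [← Real.rpow_add (by linarith)]; norm_num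
    have hmain : B₂ P * (K * Real.log |t| ^ b) ≤ ε * Real.log |t| := by
      have hla : 0 ≤ Real.log |t| ^ b := Real.rpow_nonneg (by linarith) _
      calc B₂ P * (K * Real.log |t| ^ b) = (B₂ P * K / ε) * ε * Real.log |t| ^ b := by
            field_simp
        _ ≤ Real.log |t| ^ (1 - b) * ε * Real.log |t| ^ b := by gcongr
        _ = ε * (Real.log |t| ^ b * Real.log |t| ^ (1 - b)) := by ring
        _ = ε * Real.log |t| := by rw [← hsplit]
    have hLz' : ‖G z‖ ≤ ε * Real.log |t| := by
      calc ‖G z‖ ≤ B₂ P * (K * Real.log |t|) ^ b := hLz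
        _ ≤ B₂ P * (K * Real.log |t| ^ b) := by gcongr
        _ ≤ ε * Real.log |t| := hmain
    -- `‖Z z‖ = exp (Re G z) ≤ exp ‖G z‖ ≤ |t|^ε`
    rw [← hexp z hzball, norm_exp]
    have hre : (G z).re ≤ ε * Real.log |t| := le_trans (re_le_norm _) hLz'
    calc Real.exp (G z).re ≤ Real.exp (ε * Real.log |t|) := Real.exp_le_exp.mpr hre
      _ = |t| ^ ε := by rw [Real.rpow_def_of_pos htpos, mul_comm]
      _ ≤ Real.exp (BL P) * |t| ^ ε := le_mul_of_one_le_left (by positivity) hexpBL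
  · -- `σ > 3/2`: `Z = exp L`, `‖exp L‖ ≤ exp ‖L‖ ≤ exp B_L`
    rw [not_le] at hσ5
    have hre : 3 / 2 ≤ ((σ : ℂ) + t * I).re := by simp; linarith
    have hre1 : 1 < ((σ : ℂ) + t * I).re := by linarith
    rw [Z_eq_exp_eulerLog hθ.le hN hre1, norm_exp]
    have h1 : (eulerLog P (σ + t * I)).re ≤ BL P := le_trans (re_le_norm _) (norm_eulerLog_le_BL hB hre)
    calc Real.exp (eulerLog P (σ + t * I)).re ≤ Real.exp (BL P) := Real.exp_le_exp.mpr h1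
      _ ≤ Real.exp (BL P) * |t| ^ ε := le_mul_of_one_le_right (by positivity) htε

/-- **The Mellin transform of `E` along `Re s = σ₁`** (`θ < σ₁ < 1`): for every `ε > 0` there is
`K` with `‖∫₁^∞ E(x) x^{−σ₁−1+it} dx‖ ≤ K (1 + |t|)^{ε−1}` for all real `t` — from
`Z(s) = as/(s−1) + s·∫₁^∞ E x^{−s−1}` at `s = σ₁ − it` and Theorem 2.3 for `|t|` large, and from
`‖∫‖ ≤ C/(σ₁ − θ)` for `|t|` small. [cite: Hilberdink2005, §3 Theorem A] -/
theorem exists_norm_mellin_errN_le (ha : 0 < a) (hθ0 : 0 ≤ θ) (hθ : θ < 1) (hN : ∀ x : ℝ, 1 ≤ x → |(P.intCount x : ℝ) - a * x| ≤ C * x ^ θ)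
    (hψ : ∀ x : ℝ, 1 ≤ x → |P.chebyshevPsi x - x| ≤ C * x ^ θ) {σ₁ : ℝ} (hσ₁ : θ < σ₁) (hσ₁' : σ₁ < 1)
    {ε : ℝ} (hε : 0 < ε) (hε1 : ε ≤ 1) :
    ∃ K : ℝ, ∀ t : ℝ, ‖mellin (errN P a) (-σ₁ + t * I)‖ ≤ K * (1 + |t|) ^ (ε - 1) := by
  set δ : ℝ := min ((σ₁ - θ) / 2) (1 / 4) with hδdef
  have hδ : 0 < δ := lt_min (by linarith) (by norm_num)
  have hδ2 : δ ≤ 1 / 4 := min_le_right _ _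
  have hσδ : θ + 2 * δ ≤ σ₁ := by
    have := min_le_left ((σ₁ - θ) / 2) (1 / 4); rw [← hδdef] at this; linarith
  obtain ⟨T, hT7, hT⟩ := norm_Z_le_rpow ha hθ0 hθ hN hψ hδ hδ2 hε
  have hC := const_nonneg hN
  set K₁ : ℝ := 2 * (Real.exp (BL P) + 2 * a) with hK₁
  set K₂ : ℝ := C / (σ₁ - θ) * (1 + T) ^ (1 - ε) with hK₂
  have hK₁0 : 0 ≤ K₁ := by positivity
  have hK₂0 : 0 ≤ K₂ := by
    have : 0 ≤ C / (σ₁ - θ) := div_nonneg hC (by linarith)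
    positivity
  refine ⟨K₁ + K₂, fun t ↦ ?_⟩
  -- `s = σ₁ − it`, `−s = −σ₁ + it`
  set s : ℂ := (σ₁ : ℂ) + ((-t : ℝ) : ℂ) * I with hsdef
  have hnegs : -s = -σ₁ + t * I := by rw [hsdef]; push_cast; ring
  have hsre : s.re = σ₁ := by simp [hsdef]
  have hs1 : s ≠ 1 := by
    intro h; have := congrArg Complex.re h; rw [hsre, one_re] at this; linarith
  have hsθ : θ < s.re := by rw [hsre]; exact hσ₁
  have hpos1 : 0 < 1 + |t| := by positivity
  have hrpow_pos : 0 < (1 + |t|) ^ (ε - 1) := Real.rpow_pos_of_pos hpos1 _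
  rw [← hnegs]
  rcases le_or_gt T |t| with ht | ht
  · -- large `|t|`: use Theorem 2.3
    have ht1 : 1 ≤ |t| := by linarith
    have htpos : 0 < |t| := by linarith
    have hZ := hT σ₁ (-t) hσδ (by rwa [abs_neg])
    rw [abs_neg] at hZ
    -- `mellin E (−s) = (Z s − a s/(s−1))/s`
    have hs0 : s ≠ 0 := by
      intro h; have := congrArg Complex.re h; rw [hsre, zero_re] at this; linarith
    have hsub : s - 1 ≠ 0 := sub_ne_zero.mpr hs1
    have hM : mellin (errN P a) (-s) = (Z P a s - a * s / (s - 1)) / s := by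
      rw [Z, Ztilde]
      field_simp
      ring
    have hsim : s.im = -t := by simp [hsdef]
    have hsim1 : (s - 1).im = -t := by simp [hsdef]
    have hns : |t| ≤ ‖s‖ := by
      have h := abs_im_le_norm s
      rwa [hsim, abs_neg] at h
    have hns1 : |t| ≤ ‖s - 1‖ := by
      have h := abs_im_le_norm (s - 1)
      rwa [hsim1, abs_neg] at h
    have hnsle : ‖s‖ ≤ |t| + 1 := by
      have h1 : ‖s‖ ≤ ‖(σ₁ : ℂ)‖ + ‖((-t : ℝ) : ℂ) * I‖ := by rw [hsdef]; exact norm_add_le _ _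
      have h2 : ‖(σ₁ : ℂ)‖ = σ₁ := by rw [Complex.norm_real, Real.norm_eq_abs, abs_of_pos (by linarith)]
      have h3 : ‖((-t : ℝ) : ℂ) * I‖ = |t| := by simp
      linarith
    have h1 : ‖(a : ℂ) * s / (s - 1)‖ ≤ 2 * a := by
      rw [norm_div, norm_mul, Complex.norm_real, Real.norm_eq_abs, abs_of_pos ha,
        div_le_iff₀ (lt_of_lt_of_le htpos hns1)]
      nlinarith [hns1, hnsle, ha.le]
    have h2 : ‖Z P a s - a * s / (s - 1)‖ ≤ Real.exp (BL P) * |t| ^ ε + 2 * a := by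
      have hZ' : ‖Z P a s‖ ≤ Real.exp (BL P) * |t| ^ ε := hZ
      exact (norm_sub_le _ _).trans (add_le_add hZ' h1)
    have htε : 1 ≤ |t| ^ ε := Real.one_le_rpow ht1 hε.le
    have h3 : Real.exp (BL P) * |t| ^ ε + 2 * a ≤ (Real.exp (BL P) + 2 * a) * |t| ^ ε := by
      nlinarith [ha.le, Real.exp_pos (BL P)]
    -- `|t|^{ε−1} ≤ 2^{1−ε} (1+|t|)^{ε−1} ≤ 2 (1+|t|)^{ε−1}`
    have h4 : |t| ^ ε / |t| ≤ 2 * (1 + |t|) ^ (ε - 1) := by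
      have e1 : |t| ^ ε / |t| = |t| ^ (ε - 1) := by
        rw [Real.rpow_sub htpos, Real.rpow_one]
      rw [e1]
      have e2 : (1 + |t|) ^ (ε - 1) ≥ (2 * |t|) ^ (ε - 1) :=
        Real.rpow_le_rpow_of_nonpos (by positivity) (by linarith) (by linarith)
      have e3 : (2 * |t|) ^ (ε - 1) = 2 ^ (ε - 1) * |t| ^ (ε - 1) :=
        Real.mul_rpow (by norm_num) htpos.le
      have e4 : (1 / 2 : ℝ) ≤ 2 ^ (ε - 1) := by
        calc (1 / 2 : ℝ) = 2 ^ (-1 : ℝ) := by norm_num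
          _ ≤ 2 ^ (ε - 1) := Real.rpow_le_rpow_of_exponent_le (by norm_num) (by linarith)
      have e5 : 0 ≤ |t| ^ (ε - 1) := Real.rpow_nonneg htpos.le _
      nlinarith
    rw [hM]
    calc ‖(Z P a s - a * s / (s - 1)) / s‖ = ‖Z P a s - a * s / (s - 1)‖ / ‖s‖ := norm_div _ _
      _ ≤ (Real.exp (BL P) + 2 * a) * |t| ^ ε / |t| := by
          gcongr
          exact h2.trans h3
      _ = (Real.exp (BL P) + 2 * a) * (|t| ^ ε / |t|) := by ring
      _ ≤ (Real.exp (BL P) + 2 * a) * (2 * (1 + |t|) ^ (ε - 1)) :=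
          mul_le_mul_of_nonneg_left h4 (by positivity)
      _ = K₁ * (1 + |t|) ^ (ε - 1) := by rw [hK₁]; ring
      _ ≤ (K₁ + K₂) * (1 + |t|) ^ (ε - 1) := by gcongr; linarith
  · -- small `|t|`: the trivial bound `C/(σ₁ − θ)`
    have h1 : ‖mellin (errN P a) (-s)‖ ≤ C / (σ₁ - θ) := by
      have := norm_mellin_errN_le hN hsθ; rwa [hsre] at this
    have h2 : (1 + T) ^ (ε - 1) ≤ (1 + |t|) ^ (ε - 1) :=
      Real.rpow_le_rpow_of_nonpos hpos1 (by linarith) (by linarith)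
    have h3 : C / (σ₁ - θ) ≤ K₂ * (1 + |t|) ^ (ε - 1) := by
      rw [hK₂]
      have hC' : 0 ≤ C / (σ₁ - θ) := div_nonneg hC (by linarith)
      have e1 : (1 + T) ^ (1 - ε) * (1 + T) ^ (ε - 1) = 1 := by
        rw [← Real.rpow_add (by linarith)]; norm_num
      calc C / (σ₁ - θ) = C / (σ₁ - θ) * ((1 + T) ^ (1 - ε) * (1 + T) ^ (ε - 1)) := by rw [e1, mul_one]
        _ = C / (σ₁ - θ) * (1 + T) ^ (1 - ε) * (1 + T) ^ (ε - 1) := by ring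
        _ ≤ C / (σ₁ - θ) * (1 + T) ^ (1 - ε) * (1 + |t|) ^ (ε - 1) := by
            gcongr
    calc ‖mellin (errN P a) (-s)‖ ≤ C / (σ₁ - θ) := h1
      _ ≤ K₂ * (1 + |t|) ^ (ε - 1) := h3
      _ ≤ (K₁ + K₂) * (1 + |t|) ^ (ε - 1) := by gcongr; linarith

end hyp

end Hilberdink

end Literature.NumberTheory.BeurlingPrimes
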